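import Literature.NumberTheory.Automorphic.UnboundedDenominatorsInvariantHomPrimeLevelOdd
import Literature.GroupTheory.SpecificGroups.DicyclicCentralExtension
import Summits.BirchSwinnertonDyer.BirchSwinnertonDyer.Theorems.ManinLocalTwoThreeSL2OddPrimeStableCharacterExtension
import HarnessLib

set_option autoImplicit false
-- the sub-problem namespace `Summit.BirchSwinnertonDyer.BirchSwinnertonDyer` duplicates a component by design (D-0017)
set_option linter.dupNamespace false

/-!
# K★ line `cdt_thm1`, stub `stub_hcor_invariant`: the invariant form of CDT Cor. 4.5.3 AT PRIME LEVEL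

Crux `StarredOptimalManinUnitFiveSeven` (stmt-BirchSwinnertonDyer-22226), route `EdixhovenFibreFiveSeven`, registered
skeleton `Cruxes/StarredOptimalManinUnitFiveSeven/Lines/cdt_thm1.lean` (v15).  The stub `stub_hcor_invariant` asks, for
EVERY level `N`, that an `SL₂(ℤ)`-conjugation-invariant homomorphism `θ : Γ(N) → Q` (`Q` finite abelian) be trivial on
some `Γ(M)` ([CalegariDimitrovTang2025, Cor. 4.5.3]; equivalently «`[SL₂(ℤ), Γ(N)]` is a congruence subgroup»,
[Beyl1986]).  This file proves the case of PRIME LEVEL completely: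

* `cor453_invariant_form_prime_level` — **for every prime `p` and every finite commutative `Q`, every
  `SL₂(ℤ)`-invariant `θ : Γ(p) → Q` is trivial on `Γ(12p)`** (Beyl's exact level is `lcm(p, 12)`).

Prime by prime in `|Q|` (exponent form of the transfer reduction, `UnboundedDenominatorsInvariantHomRealization`):
`ℓ = p` via `Γ₁(p)`; `ℓ ∤ p(p+1)` via the split Cartan; odd `ℓ ∣ p + 1` via the non-split Cartan
(`UnboundedDenominatorsInvariantHomPrimeLevelOdd`); and the new case here, `ℓ = 2 < p`, via the odd-index DICYCLIC
normaliser `N(⟨w⟩) ≤ SL₂(𝔽_p)` of the cell bsd-f2-manin's `ManinLocalTwoThree.SL2ZModOddPrime.exists_dicyclic_oddIndex`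
and the dicyclic central-extension lemma `Literature.GroupTheory.SpecificGroups.DicyclicCentral` (generalised quaternion
groups have trivial Schur multiplier).  Composite levels (`p² ∣ N`, `4 ∣ N`, CRT gluing) are NOT treated; the stub stays
open; K★ / Manin / BSD are not proved by this file.
-/

open scoped MatrixGroups

namespace Summit.BirchSwinnertonDyer.BirchSwinnertonDyer.Theorems

namespace HcorPrimeLevel

open CongruenceSubgroup Matrix.SpecialLinearGroup ModularGroup
open Literature.NumberTheory.Automorphic.UnboundedDenominators
open Literature.NumberTheory.EllipticCurves.ModularForms (Gamma_le_Gamma1 specialLinearGroup_map_surjective)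
open Summit.BirchSwinnertonDyer.BirchSwinnertonDyer.Theorems.ManinLocalTwoThree.SL2ZModOddPrime
  (exists_dicyclic_oddIndex)

variable {Q : Type*} [CommGroup Q]

/-- **The dicyclic local condition.**  Let `a, b ∈ SL₂(ℤ/N)` satisfy `b a b⁻¹ = a⁻¹`, `b² = a^k` and
`a^{2m} = 1 ⇒ k ∣ m`, and let `H ≤ SL₂(ℤ)` be the preimage of `⟨a, b⟩`.  Then for every `SL₂(ℤ)`-invariant
`θ : Γ(N) → Q`, `θ` kills `Γ(N) ∩ ([H, H]·K_θ)` — in the central extension `SL₂(ℤ)/K_θ` the image of `H` is a central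
extension of the dicyclic group `⟨a, b⟩`, whose commutator subgroup meets the centre trivially
(`DicyclicCentral.eq_one_of_mem_of_mem_commutator_closure`). [cite: Huppert1967, Satz V.25.3] -/
theorem dicyclic_local {N : ℕ} [NeZero N] (θ : Gamma N →* Q)
    (hθ : ∀ (g x : SL(2, ℤ)) (hx : x ∈ Gamma N) (hgx : g * x * g⁻¹ ∈ Gamma N),
      θ ⟨g * x * g⁻¹, hgx⟩ = θ ⟨x, hx⟩)
    {a b : SL(2, ZMod N)} {k : ℕ} (hab : b * a * b⁻¹ = a⁻¹) (hb2 : b ^ 2 = a ^ k)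
    (hak : ∀ m : ℕ, a ^ (2 * m) = 1 → k ∣ m) :
    ∀ (y : SL(2, ℤ)) (hy : y ∈ Gamma N),
      y ∈ ⁅(Subgroup.closure ({a, b} : Set (SL(2, ZMod N)))).comap
            (Matrix.SpecialLinearGroup.map (Int.castRingHom (ZMod N))),
          (Subgroup.closure ({a, b} : Set (SL(2, ZMod N)))).comap
            (Matrix.SpecialLinearGroup.map (Int.castRingHom (ZMod N)))⁆ ⊔ θ.ker.map (Gamma N).subtype →
      θ ⟨y, hy⟩ = 1 := by
  classical
  haveI := ker_map_subtype_normal θ hθ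
  set red := Matrix.SpecialLinearGroup.map (n := Fin 2) (Int.castRingHom (ZMod N)) with hred
  set K : Subgroup SL(2, ℤ) := θ.ker.map (Gamma N).subtype with hKdef
  set π : SL(2, ℤ) →* SL(2, ℤ) ⧸ K := QuotientGroup.mk' K with hπ
  set Z : Subgroup (SL(2, ℤ) ⧸ K) := (Gamma N).map π with hZ
  -- lifts of `a`, `b`
  obtain ⟨c, hc⟩ := specialLinearGroup_map_surjective N a
  obtain ⟨w, hw⟩ := specialLinearGroup_map_surjective N b
  set H : Subgroup SL(2, ℤ) := (Subgroup.closure ({a, b} : Set (SL(2, ZMod N)))).comap red with hH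
  have hHeq : H = Subgroup.closure ({c, w} : Set SL(2, ℤ)) ⊔ Gamma N := by
    have h1 : (Subgroup.closure ({c, w} : Set SL(2, ℤ))).map red = Subgroup.closure {a, b} := by
      rw [MonoidHom.map_closure, Set.image_insert_eq, Set.image_singleton, show red c = a from hc,
        show red w = b from hw]
    rw [hH, ← h1, Subgroup.comap_map_eq]
    rfl
  -- the central subgroup `Z` and the hypotheses of the dicyclic lemma in `G = SL₂(ℤ)/K_θ`
  have hZc : Z ≤ Subgroup.center (SL(2, ℤ) ⧸ K) := by
    rintro _ ⟨x, hx, rfl⟩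
    exact mk_mem_center_of_mem_Gamma θ hθ hx
  have hmemZ : ∀ x : SL(2, ℤ), red x = 1 → π x ∈ Z := fun x hx ↦
    Subgroup.mem_map_of_mem π ((Gamma_mem'.mpr hx : x ∈ Gamma N))
  have h1 : π w * π c * (π w)⁻¹ * π c ∈ Z := by
    rw [← map_inv, ← map_mul, ← map_mul, ← map_mul]
    refine hmemZ _ ?_
    rw [map_mul, map_mul, map_mul, map_inv, hc, hw, hab, inv_mul_cancel]
  have h2 : π w ^ 2 * (π c ^ k)⁻¹ ∈ Z := by
    rw [← map_pow, ← map_pow, ← map_inv, ← map_mul]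
    refine hmemZ _ ?_
    rw [map_mul, map_inv, map_pow, map_pow, hc, hw, hb2, mul_inv_cancel]
  have hord : ∀ i : ℤ, π c ^ (2 * i) ∈ Z → (k : ℤ) ∣ i := by
    intro i hi
    rw [← map_zpow] at hi
    obtain ⟨x, hx, hxe⟩ := hi
    -- `c^{2i} ∈ Γ(N) · K = Γ(N)`, so `a^{2i} = 1`
    have hmem : c ^ (2 * i) ∈ Gamma N := by
      rw [hπ, QuotientGroup.mk'_eq_mk'] at hxe
      obtain ⟨z, hz, hze⟩ := hxe
      rw [← hze]
      exact mul_mem hx (ker_map_subtype_le θ hz)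
    have ha : a ^ (2 * i) = 1 := by
      rw [← hc, ← map_zpow]
      exact Gamma_mem'.mp hmem
    -- pass to natural numbers
    have hnat : a ^ (2 * i.natAbs) = 1 := by
      rcases Int.natAbs_eq i with h | h
      · have : (2 * i : ℤ) = ((2 * i.natAbs : ℕ) : ℤ) := by rw [h]; simp
        rw [this, zpow_natCast] at ha; exact ha
      · have : (2 * i : ℤ) = -((2 * i.natAbs : ℕ) : ℤ) := by omega
        rw [this, zpow_neg, inv_eq_one, zpow_natCast] at ha; exact ha
    exact Int.ofNat_dvd_left.mpr (hak _ hnat)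
  -- the local condition
  intro y hy hyc
  have hπy : π y ∈ Z := Subgroup.mem_map_of_mem π hy
  have hπyc : π y ∈ ⁅Subgroup.closure ({π c, π w} ∪ (Z : Set (SL(2, ℤ) ⧸ K))),
      Subgroup.closure ({π c, π w} ∪ (Z : Set (SL(2, ℤ) ⧸ K)))⁆ := by
    have hL : Subgroup.closure ({π c, π w} ∪ (Z : Set (SL(2, ℤ) ⧸ K))) = H.map π := by
      rw [Subgroup.closure_union, Subgroup.closure_eq, hHeq, Subgroup.map_sup, MonoidHom.map_closure,
        Set.image_insert_eq, Set.image_singleton]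
    rw [hL, ← Subgroup.map_commutator]
    have h3 : y ∈ ⁅H, H⁆ ⊔ K := hyc
    rw [Subgroup.mem_sup_of_normal_right] at h3
    obtain ⟨u, hu, v, hv, rfl⟩ := h3
    refine ⟨u, hu, ?_⟩
    have hv1 : π v = 1 := by
      rw [hπ, QuotientGroup.mk'_apply]
      exact (QuotientGroup.eq_one_iff v).mpr hv
    rw [map_mul, hv1, mul_one]
  have hone := Literature.GroupTheory.SpecificGroups.DicyclicCentral.eq_one_of_mem_of_mem_commutator_closure
    Z hZc (π c) (π w) k h1 h2 hord hπy hπyc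
  have hyK : y ∈ K := by rwa [← QuotientGroup.ker_mk' K, MonoidHom.mem_ker]
  obtain ⟨_, h⟩ := (mem_ker_map_subtype_iff θ).mp hyK
  exact h

/-- **The `2`-primary targets at odd prime level**: for an odd prime `p` and an `SL₂(ℤ)`-invariant `θ : Γ(p) → Q` with
`θ(x)^{2^a} = 1` for all `x`, `θ` is trivial on `Γ(12p)` (transfer to the odd-index dicyclic normaliser of
`SL₂(𝔽_p)`). [cite: CalegariDimitrovTang2025, Corollary 4.5.3] -/
theorem map_eq_one_of_mem_Gamma_mul_of_pow_two_pow {p : ℕ} (hp : p.Prime) (hp2 : p ≠ 2) (θ : Gamma p →* Q)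
    (hθ : ∀ (g x : SL(2, ℤ)) (hx : x ∈ Gamma p) (hgx : g * x * g⁻¹ ∈ Gamma p),
      θ ⟨g * x * g⁻¹, hgx⟩ = θ ⟨x, hx⟩)
    {a : ℕ} (he : ∀ x : Gamma p, θ x ^ (2 ^ a) = 1) :
    ∀ (x : SL(2, ℤ)) (hx : x ∈ Gamma p), x ∈ Gamma (12 * p) → θ ⟨x, hx⟩ = 1 := by
  haveI : Fact p.Prime := ⟨hp⟩
  haveI : NeZero p := ⟨hp.ne_zero⟩
  haveI := ker_map_subtype_normal θ hθ
  obtain ⟨a₀, b₀, k, -, hab, hb2, hak, hidx⟩ := exists_dicyclic_oddIndex (q := p) hp2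
  set H : Subgroup SL(2, ℤ) := (Subgroup.closure ({a₀, b₀} : Set (SL(2, ZMod p)))).comap
    (Matrix.SpecialLinearGroup.map (Int.castRingHom (ZMod p))) with hH
  have hidxH : H.index = (Subgroup.closure ({a₀, b₀} : Set (SL(2, ZMod p)))).index :=
    Subgroup.index_comap_of_surjective _ (specialLinearGroup_map_surjective p)
  haveI : H.FiniteIndex := ⟨by rw [hidxH]; exact Subgroup.FiniteIndex.index_ne_zero⟩
  have hΓ : Gamma p ≤ H := by
    intro x hx
    rw [hH, Subgroup.mem_comap, (Gamma_mem'.mp hx)]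
    exact one_mem _
  have hcop : (2 ^ a).Coprime H.index := by
    rw [hidxH]
    exact Nat.Coprime.pow_left _ (Nat.coprime_two_left.mpr hidx)
  exact map_eq_one_of_mem_Gamma_mul_of_local_of_pow_eq_one θ hθ H hΓ he hcop (dicyclic_local θ hθ hab hb2 hak)

/-- **The invariant form of CDT Cor. 4.5.3 at prime level.**  For every prime `p`, every finite commutative group `Q`
and every `SL₂(ℤ)`-conjugation-invariant homomorphism `θ : Γ(p) → Q`, `θ` is trivial on `Γ(12p)`.
(`ℓ = p`: `Γ₁(p)`; `ℓ ∤ p(p+1)`: split Cartan; odd `ℓ ∣ p+1`: non-split Cartan; `ℓ = 2 < p`: dicyclic normaliser.)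
[cite: CalegariDimitrovTang2025, Corollary 4.5.3] [cite: Beyl1986, Theorem] -/
theorem cor453_invariant_form_prime_level {p : ℕ} (hp : p.Prime) (Q : Type*) [CommGroup Q] [Finite Q]
    (θ : Gamma p →* Q)
    (hθ : ∀ (g x : SL(2, ℤ)) (hx : x ∈ Gamma p) (hgx : g * x * g⁻¹ ∈ Gamma p),
      θ ⟨g * x * g⁻¹, hgx⟩ = θ ⟨x, hx⟩) :
    ∀ (x : SL(2, ℤ)) (hx : x ∈ Gamma p), x ∈ Gamma (12 * p) → θ ⟨x, hx⟩ = 1 := by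
  haveI : NeZero p := ⟨hp.ne_zero⟩
  haveI : Fact p.Prime := ⟨hp⟩
  intro x hx hx12
  set n : ℕ := Nat.card Q with hn
  have hn0 : n ≠ 0 := Nat.card_pos.ne'
  have hinv : ∀ k : ℕ, ∀ (g y : SL(2, ℤ)) (hy : y ∈ Gamma p) (hgy : g * y * g⁻¹ ∈ Gamma p),
      ((powMonoidHom k).comp θ) ⟨g * y * g⁻¹, hgy⟩ = ((powMonoidHom k).comp θ) ⟨y, hy⟩ := by
    intro k g y hy hgy
    simp only [MonoidHom.comp_apply, hθ g y hy hgy]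
  have hpow : ∀ (k : ℕ) (y : Gamma p), ((powMonoidHom k).comp θ) y = θ y ^ k := fun k y ↦ rfl
  -- prime by prime
  suffices key : ∀ ℓ : ℕ, ℓ.Prime → ℓ ∣ n → θ ⟨x, hx⟩ ^ (ordCompl[ℓ] n) = 1 by
    by_contra hne
    have hord : orderOf (θ ⟨x, hx⟩) ≠ 1 := fun h1 ↦ hne (orderOf_eq_one_iff.mp h1)
    obtain ⟨ℓ, hℓ, hℓq⟩ := Nat.exists_prime_and_dvd hord
    have hℓn : ℓ ∣ n := hℓq.trans (orderOf_dvd_of_pow_eq_one (hn ▸ pow_card_eq_one'))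
    have h1 : ℓ ∣ ordCompl[ℓ] n := hℓq.trans (orderOf_dvd_of_pow_eq_one (key ℓ hℓ hℓn))
    exact hℓ.one_lt.ne' (Nat.Coprime.eq_one_of_dvd (Nat.coprime_ordCompl hℓ hn0) h1)
  intro ℓ hℓ hℓn
  set e : ℕ := ordProj[ℓ] n with he_def
  set m : ℕ := ordCompl[ℓ] n with hm_def
  have hnm : e * m = n := Nat.ordProj_mul_ordCompl_eq_self n ℓ
  have he : ∀ y : Gamma p, ((powMonoidHom m).comp θ) y ^ e = 1 := by
    intro y
    rw [hpow, ← pow_mul, mul_comm, hnm, hn]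
    exact pow_card_eq_one'
  suffices h : ((powMonoidHom m).comp θ) ⟨x, hx⟩ = 1 by rwa [hpow] at h
  haveI := ker_map_subtype_normal ((powMonoidHom m).comp θ) (hinv m)
  by_cases hℓp : ℓ = p
  · -- `ℓ = p`: `Γ₁(p)`
    have hcop : e.Coprime (Gamma1 p).index := by
      rw [he_def, hℓp, index_Gamma1_prime hp]
      refine Nat.Coprime.pow_left _ (Nat.Coprime.mul_right ?_ ?_)
      · exact Nat.coprime_self_add_right.mpr (Nat.coprime_one_right p)
      · have h : p = 1 + (p - 1) := (Nat.add_sub_cancel' hp.one_le).symm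
        conv_lhs => rw [h]
        exact Nat.coprime_add_self_left.mpr (Nat.coprime_one_left _)
    exact map_eq_one_of_mem_Gamma_mul_of_local_of_pow_eq_one ((powMonoidHom m).comp θ) (hinv m)
      (Gamma1 p) (Gamma_le_Gamma1 p) he hcop (fun y hy hyc ↦ by
        rw [sup_eq_right.mpr (commutator_Gamma1_le_ker _ (hinv m))] at hyc
        obtain ⟨_, h⟩ := (mem_ker_map_subtype_iff _).mp hyc
        exact h) x hx hx12
  · have hℓp' : Nat.Coprime ℓ p := (Nat.coprime_primes hℓ hp).mpr hℓp
    by_cases hℓs : ℓ ∣ p + 1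
    · rcases hℓ.eq_two_or_odd' with rfl | hℓodd
      · -- `ℓ = 2 < p`: the dicyclic normaliser
        have he2 : ∀ y : Gamma p, ((powMonoidHom m).comp θ) y ^ (2 ^ n.factorization 2) = 1 := he
        exact map_eq_one_of_mem_Gamma_mul_of_pow_two_pow hp (fun h ↦ hℓp h.symm) ((powMonoidHom m).comp θ)
          (hinv m) he2 x hx hx12
      · -- odd `ℓ ∣ p + 1`: the non-split Cartan
        have hℓ2 : ℓ ≠ 2 := by rintro rfl; exact (Nat.not_even_iff_odd.mpr hℓodd) even_two
        have hℓd : ¬ ℓ ∣ p - 1 := by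
          intro hd
          have h2 : ℓ ∣ (p + 1) - (p - 1) := Nat.dvd_sub hℓs hd
          have : (p + 1) - (p - 1) = 2 := by have := hp.one_le; omega
          rw [this] at h2
          exact hℓ2 ((Nat.prime_dvd_prime_iff_eq hℓ Nat.prime_two).mp h2)
        obtain ⟨cbar, hcbar⟩ := exists_zpowers_index_eq_mul_pred hp
        have hcop : e.Coprime (Subgroup.zpowers cbar).index := by
          rw [hcbar, he_def]
          exact Nat.Coprime.pow_left _
            (Nat.Coprime.mul_right hℓp' ((Nat.Prime.coprime_iff_not_dvd hℓ).mpr hℓd))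
        exact map_eq_one_of_mem_Gamma_mul_of_zpowers_of_pow_eq_one ((powMonoidHom m).comp θ) (hinv m)
          cbar he hcop x hx hx12
    · -- `ℓ ∤ p (p + 1)`: the split Cartan
      obtain ⟨cbar, hcbar⟩ := exists_zpowers_index_eq_mul_succ hp
      have hcop : e.Coprime (Subgroup.zpowers cbar).index := by
        rw [hcbar, he_def]
        exact Nat.Coprime.pow_left _
          (Nat.Coprime.mul_right hℓp' ((Nat.Prime.coprime_iff_not_dvd hℓ).mpr hℓs))
      exact map_eq_one_of_mem_Gamma_mul_of_zpowers_of_pow_eq_one ((powMonoidHom m).comp θ) (hinv m)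
        cbar he hcop x hx hx12

/-- **Prime level, in the exact shape of `stub_hcor_invariant`** (restricted to `N = p` prime): `M = 12p`.
K★ / Manin / BSD are NOT proved by this. [cite: CalegariDimitrovTang2025, Corollary 4.5.3] -/
theorem stub_hcor_invariant_prime_level {p : ℕ} (hp : p.Prime) (Q : Type) [CommGroup Q] [Finite Q]
    (θ : Gamma p →* Q)
    (hθ : ∀ (g x : SL(2, ℤ)) (hx : x ∈ Gamma p) (hgx : g * x * g⁻¹ ∈ Gamma p),
      θ ⟨g * x * g⁻¹, hgx⟩ = θ ⟨x, hx⟩) :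
    ∃ M : ℕ, M ≠ 0 ∧ ∀ (x : SL(2, ℤ)) (hx : x ∈ Gamma p), x ∈ Gamma M → θ ⟨x, hx⟩ = 1 :=
  ⟨12 * p, Nat.mul_ne_zero (by norm_num) hp.ne_zero, cor453_invariant_form_prime_level hp Q θ hθ⟩

end HcorPrimeLevel

end Summit.BirchSwinnertonDyer.BirchSwinnertonDyer.Theorems
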